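import Summits.BirchSwinnertonDyer.Rank1Residual.X11b.YZCompositeOfFrames
import HarnessLib

/-!
# Crux stmt-BirchSwinnertonDyer-23730 `PrintX10b.TwoSidedLinkAnyClassNumberX10b` (B₃) AT EVERY CLASS
# NUMBER from the four single-source print facts, JSW 2017 Thm. 3.3.1, and ONE transfer statement:
# Yan–Zhu 2026 Thm. 5.9 (2) ⟹ (1) at the trivial localisation, READ WITHOUT `p ∤ h_K`

Cell `run/shared/lean/pub/bsd-print-x9/`, seat `bsd-line-x10b-p3` (D-0154 row 10; lead of line
`composite-transfer-x10b` on crux 23730). HONEST FRAMING: theorems only (no definition, no named fact, no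
`sorry`); `--supports stmt-BirchSwinnertonDyer-23730`; the crux is NOT closed (every theorem below is
CONDITIONAL on named print facts and on the explicit transfer hypothesis `h59g`); BSD is not proved by
any of this and no summit statement is proved by this seat.

## What this file records (the kernel form of the line's finding)

In the tree, the `p ∣ h_K` regime of B₃ (the registered stub
`stub_compositeValuationThree_divisibleClassNumber`) is "beyond print BY NAME" through exactly ONE
binder: the field `YanZhu2026.Thm57Hypotheses.not_dvd_classNumber` consumed by the typed Heegner ⟺ BDP
transfer `YanZhu2026.thm59_XGr_isTorsion_bdp_iff_heegnerPoint_localised` (Yan–Zhu 2026 Thm. 5.9) inside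
the kernel derivation `X11b.YZComposite.thm57_thm59_bcs422_cgls513_of_heegnerDivisibility_of_printFacts`
(its l.146; used once). The other inputs carry NO class-number binder as typed: Thm. 5.7 (1)
(`thm57_isTorsion_charIdealXGr_eq_bdpLFunction`, used ⊗ ℚ_p — so the `h_K` factor of Greenberg's
`𝓛_p^Gr = h_K·𝓛_𝔭(K)′·𝓛^II`, Yan–Zhu Def. 3.10, never enters this road), BCS 2025 Prop. 4.2.2
(`prop422_…`, Hsieh's `μ = 0`), CGLS 2022 Thm. 5.1.3 (`thm513_…`), Carayol (`hC`), JSW 2017 Thm. 3.3.1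
(`h331`). In PRINT the transfer carries no class-number hypothesis either: Yan–Zhu's §5.2 setting
(J. Algebra 693; arXiv:2412.20078v2 §4.5, p. 11: "`p > 2` … good ordinary … `p = 𝔭𝔭̄` split … Heegner
hypothesis … `ρ̄_E|_{G_K}` irreducible", `κ` = Perrin-Riou's `Λ_K⁻`-adic Heegner class) and Thm. 5.9
(= v2 Thm. 4.14, "Similarly to [BCK]"; BCK21 §1.1: `p > 3`, `p ∤ D_K`, `(D_K, N) = 1`, no `h_K`). So this
file re-runs the derivation with the transfer supplied as an explicit hypothesis `h59g` = "Thm. 5.9,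
(2) ⟹ (1) at `S ⊂ (Λ_K⁻)ˣ`, for the frames of Thm. 5.7 (1)" — the binder list of
`thm57_isTorsion_charIdealXGr_eq_bdpLFunction` plus the Heegner-family embedding `jbar` and the level
identity `N = N_E`, WITHOUT `p ∤ h_K` — and obtains, at every good ordinary `p ≥ 3`:

* §1 `composite_of_printFacts_of_transfer` — the conclusion of the composite named fact
  `YanZhu2026.thm57_thm59_bcs422_cgls513_generator_constantCoeff_of_heegnerDivisibility` with the binder
  `¬ p ∣ h_K` DELETED (torsion of `𝒳_Gr`, a generator `F`, `F(0) = u·c_E⁻²(1 − a_p p⁻¹ + p⁻¹)² log_ω(P_K)²`).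
* §2 `compositeValuation_of_printFacts_of_transfer` — the same in the valuation currency
  `AcSelmer.XAc.HasCharValuationAt … n ∧ n = 2·(ord_p(1 − a_p + p) − 1 + ord_p log_ω P) − 2·ord_p c(Dt)`
  for EVERY generator with non-zero constant term (at `p = 3`: BOTH registered stubs of the line at once).
The crux B₃ itself (and the general-`p` `X11b.IMCWaldspurgerOnTreeGoodAt` form) follow in the companion
`…OfPrintFactsCrux.lean` through the landed σ-bridge (p606673).

TREE-CURRENCY CAVEAT carried by `h59g` (for the typer / referee, not hidden): Yan–Zhu's `Λ_K⁻·κ` is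
Perrin-Riou's Heegner module; the tree's `heegnerModule D F` (lim of the layer spans of `y_K` and
`z_j = Norm_{K[p^{j+1}]/K_j} P[p^{j+1}]`; `K_j ⊂ K[p^{j+1}]` at every class number since
`K[p^{j+1}] ∩ K_∞ = K_{j+δ}`, `δ` the torsion depth) is identified with it by Howard 2004 Thm. 3.3.7 under
`p ∤ h_K` only; at `δ ≥ 1` the identification is Perrin-Riou 1987 §3.4's general setting (universal norms)
and is NOT a tree theorem. `h59g` is a HYPOTHESIS here, not a typed fact; its typing (general form of
`thm59_…`, `-- TODO(general form)` in `YanZhu2026/AnticyclotomicMainTheorems.lean`) is a typer decision.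

References: [YanZhu2024MainConjNonCM] §5.2, Thm. 5.7 (1), Thm. 5.9, proof of Thm. 5.7 (arXiv:2412.20078v4
l.1189–1308; v2 §4.5 p. 11); [BurungaleCastellaKim2021] §1.1, Thm. 3.1, Thm. 4.1/5.2;
[BurungaleCastellaSkinner2025] Prop. 4.2.2, Thm. 4.2.1 (proof); [CastellaGrossiLeeSkinner2022] Thm. 5.1.3;
[Castella2018] Thm. 2.3, §5; [Howard2004HeegnerKolyvagin] §3.3, Thm. 3.3.7; [PerrinRiou1987BSMF] §3.4;
[Carayol1986]; [Darmon2004] Prop. 3.11.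
-/

-- the summit and its single problem are both named `BirchSwinnertonDyer` (registry layout D-0017)
set_option linter.dupNamespace false
set_option autoImplicit false

noncomputable section

open scoped Classical

open PowerSeries WeierstrassCurve NumberField IsDedekindDomain Field
  Literature.NumberTheory.EllipticCurves Literature.NumberTheory.EllipticCurves.ModularForms
  Literature.NumberTheory.EllipticCurves.Rank1Residual
  Literature.NumberTheory.EllipticCurves.Castella2018
  Literature.NumberTheory.EllipticCurves.YanZhu2026
  Literature.NumberTheory.EllipticCurves.CastellaGrossiLeeSkinner2022
  Summit.BirchSwinnertonDyer.Rank1Residual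
  Summit.BirchSwinnertonDyer.Rank1Residual.X11b.Halves
  Summit.BirchSwinnertonDyer.Rank1Residual.X1.KellerYinHalves
  Summit.BirchSwinnertonDyer.Rank1Residual.X11b.YZComposite

namespace Summit.BirchSwinnertonDyer.BirchSwinnertonDyer.Cruxes.TwoSidedLinkAnyClassNumberX10b.CompositeTransferX10b

/-! ## §0 A `p`-adic valuation computation (standard API; no mathematical content of its own) -/

section Valuation

variable {p : ℕ} [hp : Fact p.Prime]

/-- `ord_p` of the right-hand side of the composite: for a unit `u ∈ ℤ_p^×`, integers `c, a`, `L ∈ ℚ_p`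
and `m ∈ ℕ`, if `u · c⁻² · (1 − a p⁻¹ + p⁻¹)² · (L/m)² ≠ 0` then its valuation is
`2·(ord_p(1 − a + p) − 1 + (ord_p L − ord_p m)) − 2·ord_p c` (the computation of
`YanZhu2026/BDPMainConjectureAtTrivialCharacterOfHeegnerDivisibility.lean`, private there). [folklore] -/
theorem valuation_unit_mul_bdpShape (u : ℤ_[p]ˣ) (c a : ℤ) (L : ℚ_[p]) (m : ℕ)
    (h : ((u : ℤ_[p]) : ℚ_[p]) * ((c : ℚ_[p])⁻¹) ^ 2 *
        (1 - (a : ℚ_[p]) * (p : ℚ_[p])⁻¹ + (p : ℚ_[p])⁻¹) ^ 2 * (L / (m : ℚ_[p])) ^ 2 ≠ 0) :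
    (((u : ℤ_[p]) : ℚ_[p]) * ((c : ℚ_[p])⁻¹) ^ 2 *
        (1 - (a : ℚ_[p]) * (p : ℚ_[p])⁻¹ + (p : ℚ_[p])⁻¹) ^ 2 * (L / (m : ℚ_[p])) ^ 2).valuation =
      2 * ((padicValInt p (1 - a + p) : ℤ) - 1 + (L.valuation - (padicValNat p m : ℤ))) -
        2 * (padicValInt p c : ℤ) := by
  have hp0 : (p : ℚ_[p]) ≠ 0 := by exact_mod_cast hp.out.ne_zero
  have hu0 : ((u : ℤ_[p]) : ℚ_[p]) ≠ 0 := PadicInt.coe_ne_zero.2 u.ne_zero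
  have hc0 : ((c : ℚ_[p])⁻¹) ≠ 0 := by
    intro h0; apply h; rw [h0]; ring
  have hA0 : (1 - (a : ℚ_[p]) * (p : ℚ_[p])⁻¹ + (p : ℚ_[p])⁻¹) ≠ 0 := by
    intro h0; apply h; rw [h0]; ring
  have hLm0 : L / (m : ℚ_[p]) ≠ 0 := by
    intro h0; apply h; rw [h0]; ring
  have hL0 : L ≠ 0 := by
    intro h0; apply hLm0; rw [h0, zero_div]
  have hm0 : (m : ℚ_[p]) ≠ 0 := by
    intro h0; apply hLm0; rw [h0, div_zero]
  -- `1 − a p⁻¹ + p⁻¹ = (1 − a + p)/p`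
  have hAeq : (1 - (a : ℚ_[p]) * (p : ℚ_[p])⁻¹ + (p : ℚ_[p])⁻¹) =
      ((1 - a + p : ℤ) : ℚ_[p]) * (p : ℚ_[p])⁻¹ := by
    push_cast
    field_simp
    ring
  have hA1 : ((1 - a + p : ℤ) : ℚ_[p]) ≠ 0 := by
    intro h0; apply hA0; rw [hAeq, h0, zero_mul]
  -- valuations of the four factors
  have hvu : ((u : ℤ_[p]) : ℚ_[p]).valuation = 0 := by
    simp only [PadicInt.valuation_coe, padicInt_valuation_eq_zero_of_isUnit u.isUnit, Nat.cast_zero]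
  have hvc : ((c : ℚ_[p])⁻¹).valuation = -(padicValInt p c : ℤ) := by
    rw [Padic.valuation_inv, Padic.valuation_intCast]
  have hvA : (1 - (a : ℚ_[p]) * (p : ℚ_[p])⁻¹ + (p : ℚ_[p])⁻¹).valuation =
      (padicValInt p (1 - a + p) : ℤ) - 1 := by
    rw [hAeq, Padic.valuation_mul hA1 (inv_ne_zero hp0), Padic.valuation_intCast,
      Padic.valuation_inv, Padic.valuation_p]
    ring
  have hvL : (L / (m : ℚ_[p])).valuation = L.valuation - (padicValNat p m : ℤ) := by
    rw [div_eq_mul_inv, Padic.valuation_mul hL0 (inv_ne_zero hm0), Padic.valuation_inv,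
      Padic.valuation_natCast]
    ring
  rw [Padic.valuation_mul (mul_ne_zero (mul_ne_zero hu0 (pow_ne_zero 2 hc0)) (pow_ne_zero 2 hA0))
      (pow_ne_zero 2 hLm0),
    Padic.valuation_mul (mul_ne_zero hu0 (pow_ne_zero 2 hc0)) (pow_ne_zero 2 hA0),
    Padic.valuation_mul hu0 (pow_ne_zero 2 hc0), Padic.valuation_pow, Padic.valuation_pow,
    Padic.valuation_pow, hvu, hvc, hvA, hvL]
  ring

end Valuation

/-! ## §1 The composite at the trivial character, `¬ p ∣ h_K` DELETED, from the print facts and the transfer -/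

section Composite

/-- **Yan–Zhu 2026 Thm. 5.7 (1) + [Thm. 5.9, (2) ⟹ (1) at `S ⊂ Λˣ`, read WITHOUT `p ∤ h_K`] + BCS 2025
Prop. 4.2.2 + CGLS 2022 Thm. 5.1.3 at the trivial character, GRANTED Howard's containment — the
conclusion of the composite named fact
`YanZhu2026.thm57_thm59_bcs422_cgls513_generator_constantCoeff_of_heegnerDivisibility` AT EVERY CLASS
NUMBER.** Verbatim the kernel derivation `X11b.YZComposite.thm57_thm59_bcs422_cgls513_of_heegnerDivisibility_of_printFacts`
(ty1 g16) with its single use of `Thm57Hypotheses.not_dvd_classNumber` (the typed Thm. 5.9) replaced by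
the explicit transfer hypothesis `h59g` (Thm. 5.9's second bullet ⟹ first bullet at the trivial
localisation, for the binder list of `thm57_isTorsion_charIdealXGr_eq_bdpLFunction` + `jbar` + `N = N_E`,
NO class-number binder — Yan–Zhu's §5.2 setting carries none). Per datum: Carayol (`hC`) gives `N = N_E`;
an embedding datum `ι'` inducing `v`; the frames `L₁` (5.7 (1): torsion, `p^k'·(F) ⊆ (L₁)`), `L₃` (`h59g`
fed with the containment: `L₃ ∈ (F)`), `L₂` (4.2.2: a unit coefficient), `L₄` (5.1.3 at `τ_* P`) of the
SAME `(ι', v, κ, γ, f_E)` generate the same ideal / have the same constant term (frame rigidity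
`X11b.R1.span_singleton_eq_of_isBDPLFunction`, `X11b.constantCoeff_eq_of_isBDPLFunction`); the
μ-comparison gives `(F)·R₀⟦T⟧ = (L₁)`; `(log τ_* P)² = (log P)²` (Darmon Prop. 3.11, discharged);
`F(0) = u'·V`. [cite: YanZhu2024MainConjNonCM, Thm. 5.7 (1) and Thm. 5.9 (arXiv:2412.20078v4 TeX l.1217–1227, l.1283–1293), §5.2 setting l.1189–1190, proof of Thm. 5.7 (l.1294–1308)]
[cite: BurungaleCastellaSkinner2025, Prop. 4.2.2 (p. 9) and Thm. 4.2.1, proof (p. 8)]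
[cite: CastellaGrossiLeeSkinner2022, Thm. 5.1.3] [cite: Carayol1986] [cite: Darmon2004, Prop. 3.11]
[cite: Castella2018, Thm. 3.1 (the frame `IsBDPLFunction`)] -/
theorem composite_of_printFacts_of_transfer
    (h57 : thm57_isTorsion_charIdealXGr_eq_bdpLFunction)
    (h59g : ∀ {p : ℕ} [Fact p.Prime] (ι' : PadicAlgCl p ≃+* ℂ) (W : WeierstrassCurve ℚ) [W.IsElliptic]
      [W.IsGloballyMinimal] (K : Type) [Field K] [NumberField K] (v vbar : HeightOneSpectrum (𝓞 K))
      (κ : ZpExtension K p) (γ : absoluteGaloisGroup K) [Fact (κ.IsTopGenerator γ)] {N : ℕ} [NeZero N]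
      {f : CuspForm (CongruenceSubgroup.Gamma0 N) 2} (jbar : AlgebraicClosure K →+* ℂ)
      (_ : IsNewformOf W f),
      N = W.conductorNorm ℤ → 3 ≤ p → GoodOrd W p → (W.baseChange K).HasIrreducibleModPGaloisRep p →
      IsImaginaryQuadratic K → SatisfiesHeegnerHypothesis N K →
        ((Ideal.span {(p : ℤ)}).primesOver (𝓞 K)).ncard = 2 →
        Odd (NumberField.discr K) → NumberField.discr K ≠ -3 → κ.IsAnticyclotomic →
      (∀ (w : InfinitePlace K) (k : 𝓞 K), k ∈ v.asIdeal ↔ ‖ι'.symm (w.embedding (k : K))‖ < 1) →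
        ((p : ℕ) : 𝓞 K) ∈ vbar.asIdeal → vbar ≠ v →
      ∃ (ΩK : ℂ) (Ωp : (unrIntegers p)ˣ) (L : UnrSeries p),
        ΩK ≠ 0 ∧ IsBDPLFunction ι' v κ γ f ΩK ((Ωp : unrIntegers p) : ℂ_[p]) L ∧
        ∀ (D : (W.baseChange K).LambdaAdicSelmerData κ γ) (F : HeegnerFamily N W K κ jbar)
          (X : (W.baseChange K).SelmerDualData κ γ) (j : ℤ_[p] →+* unrIntegers p),
          (∀ x : ℤ_[p], ((j x : unrIntegers p) : ℂ_[p]) = algebraMap ℚ_[p] ℂ_[p] (x : ℚ_[p])) →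
          heegnerCharIdeal D F ^ 2 ≤
              Module.charIdeal (IwasawaAlgebra p) (Submodule.torsion (IwasawaAlgebra p) X.X) →
            L ∈ (AcSelmer.XAc.charIdeal (W.baseChange K) p κ vbar ∅ γ).map (PowerSeries.map j))
    (h422 : BurungaleCastellaSkinner2025.prop422_exists_isBDPLFunction_mu_eq_zero)
    (h513 : thm513_exists_isBDPLFunction_valueAtOne_disc)
    (hC : ∀ (N : ℕ) [NeZero N], IsNewformOf.level_eq_conductorNorm (N := N)) :
    ∀ (W : WeierstrassCurve ℚ) [W.IsElliptic] [W.IsGloballyMinimal] (p : ℕ) [Fact p.Prime],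
      3 ≤ p → GoodOrd W p →
      ∀ (K : Type) [Field K] [NumberField K], IsImaginaryQuadratic K →
        SatisfiesHeegnerHypothesis (W.conductorNorm ℤ) K → SatisfiesHeegnerHypothesis p K →
        Odd (NumberField.discr K) → NumberField.discr K ≠ -3 →
        (W.baseChange K).HasIrreducibleModPGaloisRep p →
      ∀ (ι : K →+* ℚ_[p]) (v vbar : HeightOneSpectrum (𝓞 K)),
        (∀ x : 𝓞 K, x ∈ v.asIdeal ↔ ‖ι (x : K)‖ < 1) →
        ((p : ℕ) : 𝓞 K) ∈ vbar.asIdeal → vbar ≠ v →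
      ∀ (κ : ZpExtension K p), κ.IsAnticyclotomic →
      ∀ (γ : absoluteGaloisGroup K) [Fact (κ.IsTopGenerator γ)],
      ∀ (N : ℕ) [NeZero N] (Dt : ModularParametrizationData W N)
        (H : HeegnerDatum N (NumberField.discr K)) (ιC : K →+* ℂ) (P : (W.baseChange K).toAffine.Point),
        WeierstrassCurve.Affine.Point.map ιC.toRatAlgHom P = heegnerPointComplex Dt H →
        (∃ (jbar : AlgebraicClosure K →+* ℂ) (D : (W.baseChange K).LambdaAdicSelmerData κ γ)
            (F : HeegnerFamily N W K κ jbar) (X : (W.baseChange K).SelmerDualData κ γ),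
            heegnerCharIdeal D F ^ 2 ≤
              Module.charIdeal (IwasawaAlgebra p) (Submodule.torsion (IwasawaAlgebra p) X.X)) →
        Module.IsTorsion (IwasawaAlgebra p) (AcSelmer.XAc (W.baseChange K) p κ vbar ∅ γ) ∧
        ∃ F : IwasawaAlgebra p,
          AcSelmer.XAc.charIdeal (W.baseChange K) p κ vbar ∅ γ = Ideal.span {F} ∧
          ∃ u : ℤ_[p]ˣ,
            ((PowerSeries.constantCoeff F : ℤ_[p]) : ℚ_[p]) =
              ((u : ℤ_[p]) : ℚ_[p]) * ((Dt.c : ℚ_[p])⁻¹) ^ 2 *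
                (1 - (W.frobeniusTrace p : ℚ_[p]) * (p : ℚ_[p])⁻¹ + (p : ℚ_[p])⁻¹) ^ 2 *
                ((W.baseChange ℚ_[p]).padicLogPoint (formalIndex W p • padicPointOf W p ι P) /
                  (formalIndex W p : ℚ_[p])) ^ 2 := by
  intro W _ _ p _ hp hord K _ _ hK hHN hHp hodd h3 hirrK ι v vbar hv hvbar hne κ hκ γ _ N _ Dt H
    ιC P hP hHow
  have hpp : p.Prime := Fact.out
  have hp2 : p ≠ 2 := by omega
  have hp2' : 2 < p := by omega
  have hγ : κ.IsTopGenerator γ := Fact.out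
  -- Carayol: the level of the parametrisation datum is the conductor
  have hNc : N = W.conductorNorm ℤ := hC N Dt.isNewformOf
  subst hNc
  -- `p ∈ v`, `p` split, `p ∤ N_E`, the embedding datum `ι'` inducing `v`
  have hpv : ((p : ℕ) : 𝓞 K) ∈ v.asIdeal := by
    rw [hv, show ι (((p : ℕ) : 𝓞 K) : K) = (p : ℚ_[p]) by simp]
    exact Padic.norm_p_lt_one
  have hsplit : ((Ideal.span {(p : ℤ)}).primesOver (𝓞 K)).ncard = 2 := hHp p hpp (dvd_refl p)
  have hgood : W.HasGoodReductionAtPrime p := hord.1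
  have hpN : ¬ p ∣ W.conductorNorm ℤ := fun h ↦
    (W.dvd_conductorNorm_iff_not_hasGoodReductionAtPrime p).mp h hgood
  obtain ⟨ι₀⟩ := PadicAlgCl.nonempty_ringEquiv_complex p
  obtain ⟨ι', -, hι'⟩ := X11b.exists_datum_forall_mem_iff p ι₀ hK hpv
  -- frame 1: Thm. 5.7 (1) — torsion and the rational `⊆`
  obtain ⟨ΩK₁, Ωp₁, L₁, hΩK₁, hL₁, htors, hrat⟩ :=
    h57 ι' W K v vbar κ γ Dt.isNewformOf hp hord hirrK hK hHN hsplit hodd h3 hι' hvbar hne hκ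
  obtain ⟨⟨-, k', hk'⟩, -⟩ := hrat (toUnr p) (coe_toUnr p)
  -- frame 3: the transfer (Thm. 5.9, (2) ⟹ (1) at `S ⊂ Λˣ`, no class-number binder) fed with Howard's
  -- containment — `L₃ ∈ ch·R₀⟦T⟧`
  obtain ⟨jbar, D, Fh, X, hle⟩ := hHow
  obtain ⟨ΩK₃, Ωp₃, L₃, hΩK₃, hL₃, hmem⟩ :=
    h59g ι' W K v vbar κ γ jbar Dt.isNewformOf rfl hp hord hirrK hK hHN hsplit hodd h3 hκ hι' hvbar hne
  have hL₃mem := hmem D Fh X (toUnr p) (coe_toUnr p) hle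
  -- frame 2: Prop. 4.2.2 — a unit coefficient
  obtain ⟨ΩK₂, Ωp₂, L₂, hΩK₂, hL₂, hμ⟩ :=
    h422 ι' W K v κ γ Dt.isNewformOf hp2' hgood hK hHN hsplit hodd h3 hirrK hpv hι' hκ hγ
  -- frame 4: Thm. 5.1.3 at `τ_* P`, read through THE infinite place
  obtain ⟨w₀⟩ := (inferInstance : Nonempty (InfinitePlace K))
  obtain ⟨τ, hP'⟩ := exists_algHom_map_map_eq hK ιC w₀ Dt H hP
  obtain ⟨ΩK₄, Ωp₄, L₄, hΩK₄, hL₄, u, hu⟩ :=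
    h513 ι' W K v κ γ Dt H w₀ ι (WeierstrassCurve.Affine.Point.map (W' := W) τ P) hp2 hpN hK hsplit
      hpv hι' hHN hodd h3 hκ hγ hP' hv
  -- frame rigidity: same ideal, same constant term
  have hΩp₁ := X11b.YZComposite.coe_units_ne_zero Ωp₁
  have hΩp₂ := X11b.YZComposite.coe_units_ne_zero Ωp₂
  have hΩp₃ := X11b.YZComposite.coe_units_ne_zero Ωp₃
  have hΩp₄ := X11b.YZComposite.coe_units_ne_zero Ωp₄
  have h21 : Ideal.span ({L₂} : Set (UnrSeries p)) = Ideal.span {L₁} :=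
    X11b.R1.span_singleton_eq_of_isBDPLFunction hp2 hK hκ hγ hΩK₁ hΩK₂ hΩp₁ hΩp₂ hL₁ hL₂
  have h31 : Ideal.span ({L₃} : Set (UnrSeries p)) = Ideal.span {L₁} :=
    X11b.R1.span_singleton_eq_of_isBDPLFunction hp2 hK hκ hγ hΩK₁ hΩK₃ hΩp₁ hΩp₃ hL₁ hL₃
  have h41 : PowerSeries.constantCoeff L₄ = PowerSeries.constantCoeff L₁ :=
    X11b.constantCoeff_eq_of_isBDPLFunction hp2 hK hκ hγ hΩK₁ hΩK₄ hΩp₁ hΩp₄ hL₁ hL₄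
  -- a generator `F` of `ch_Λ(𝒳)`; the extended ideal is `(F')`, `F' = map toUnr F`
  obtain ⟨F, hF⟩ :=
    (charIdeal_isPrincipal_holds p (Castella2018.AcSelmer.XAc (W.baseChange K) p κ vbar ∅ γ)).principal
  have hF' : Castella2018.AcSelmer.XAc.charIdeal (W.baseChange K) p κ vbar ∅ γ = Ideal.span {F} := hF
  set F' : UnrSeries p := PowerSeries.map (toUnr p) F with hF'def
  have hI : (Castella2018.AcSelmer.XAc.charIdeal (W.baseChange K) p κ vbar ∅ γ).map
      (PowerSeries.map (toUnr p)) = Ideal.span {F'} := by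
    rw [hF', Ideal.map_span, Set.image_singleton]
  -- (1) `C(p^k') · F' ∈ (L₁)`
  have h1 : C ((p : unrIntegers p) ^ k') * F' ∈ Ideal.span ({L₁} : Set (UnrSeries p)) :=
    hk' F' (by rw [hI]; exact Ideal.mem_span_singleton_self F')
  -- (2) `L₁ ∈ (F')`
  have h2 : L₁ ∈ Ideal.span ({F'} : Set (UnrSeries p)) := by
    have hL₁3 : L₁ ∈ Ideal.span ({L₃} : Set (UnrSeries p)) := by
      rw [h31]; exact Ideal.mem_span_singleton_self L₁
    rw [hI] at hL₃mem
    exact (Ideal.span_singleton_le_iff_mem _).mpr hL₃mem hL₁3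
  -- (3) `μ(L₁) = 0`
  obtain ⟨n, hn⟩ := exists_firstUnitCoeffAt_of_span_eq h21 hμ
  -- the μ-comparison: `(F') = (L₁)`
  have hspan : Ideal.span ({F'} : Set (UnrSeries p)) = Ideal.span {L₁} :=
    span_eq_of_C_pow_mul_mem_of_mem h1 h2 hn
  -- the value at `𝟙`, moved to `L₁` and to `P`
  have hlog : padicLogOmega W p ι (WeierstrassCurve.Affine.Point.map (W' := W) τ P) ^ 2 =
      padicLogOmega W p ι P ^ 2 :=
    sq_padicLogOmega_map_eq_of_isHeegnerPoint W hK hHN ι ⟨Dt, H, ιC, hP⟩ τ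
  rw [hlog] at hu
  have hval : L₁.HasValueAt 0 (((u : unrIntegers p) : ℂ_[p]) *
      algebraMap ℚ_[p] ℂ_[p] (((Dt.c : ℚ_[p])⁻¹) ^ 2 *
        (1 - (W.frobeniusTrace p : ℚ_[p]) * (p : ℚ_[p])⁻¹ + (p : ℚ_[p])⁻¹) ^ 2 *
        padicLogOmega W p ι P ^ 2)) := by
    have h0 := UnrSeries.hasValueAt_zero L₁
    rw [← h41, ← UnrSeries.eq_constantCoeff_of_hasValueAt_zero hu] at h0
    exact h0
  obtain ⟨u', hu'⟩ := exists_unit_constantCoeff_eq hspan u hval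
  refine ⟨htors, F, hF', u', ?_⟩
  rw [hu']
  unfold padicLogOmega
  ring

end Composite

/-! ## §2 The composite in the valuation currency, every class number, every generator -/

section ValuationCurrency

/-- **The class-number-free composite valuation identity** — granted the four print facts and the transfer
`h59g`: at every good ordinary `p ≥ 3` frame (Heegner for `N_E` and `p`, `d_K` odd `≠ −3`, (irr_K), ANY
class number), Howard's containment and ONE generator `G` of `Char_Λ(𝒳_Gr)` with `G(0) ≠ 0` give
`AcSelmer.XAc.HasCharValuationAt … n` with `n = 2·(ord_p(1 − a_p + p) − 1 + ord_p log_ω P) − 2·ord_p c(Dt)`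
(two generators differ by a unit of `Λ`, whose constant term is a unit of `ℤ_p`; then §0). The body of the
cells' `X11b.IMCWaldspurgerOnTreeGoodAt` up to the Manin term, with NO image and NO class-number
hypothesis. [cite: YanZhu2024MainConjNonCM, Thm. 5.7 (1) and Thm. 5.9 (arXiv:2412.20078v4 l.1217–1223, l.1283–1293)]
[cite: BurungaleCastellaSkinner2025, Prop. 4.2.2 (p. 9)] [cite: CastellaGrossiLeeSkinner2022, Thm. 5.1.3]
[cite: Castella2018, §5 (eq:IMC+BDP) (arXiv:1704.06608 p. 12)] -/
theorem compositeValuation_of_printFacts_of_transfer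
    (h57 : thm57_isTorsion_charIdealXGr_eq_bdpLFunction)
    (h59g : ∀ {p : ℕ} [Fact p.Prime] (ι' : PadicAlgCl p ≃+* ℂ) (W : WeierstrassCurve ℚ) [W.IsElliptic]
      [W.IsGloballyMinimal] (K : Type) [Field K] [NumberField K] (v vbar : HeightOneSpectrum (𝓞 K))
      (κ : ZpExtension K p) (γ : absoluteGaloisGroup K) [Fact (κ.IsTopGenerator γ)] {N : ℕ} [NeZero N]
      {f : CuspForm (CongruenceSubgroup.Gamma0 N) 2} (jbar : AlgebraicClosure K →+* ℂ)
      (_ : IsNewformOf W f),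
      N = W.conductorNorm ℤ → 3 ≤ p → GoodOrd W p → (W.baseChange K).HasIrreducibleModPGaloisRep p →
      IsImaginaryQuadratic K → SatisfiesHeegnerHypothesis N K →
        ((Ideal.span {(p : ℤ)}).primesOver (𝓞 K)).ncard = 2 →
        Odd (NumberField.discr K) → NumberField.discr K ≠ -3 → κ.IsAnticyclotomic →
      (∀ (w : InfinitePlace K) (k : 𝓞 K), k ∈ v.asIdeal ↔ ‖ι'.symm (w.embedding (k : K))‖ < 1) →
        ((p : ℕ) : 𝓞 K) ∈ vbar.asIdeal → vbar ≠ v →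
      ∃ (ΩK : ℂ) (Ωp : (unrIntegers p)ˣ) (L : UnrSeries p),
        ΩK ≠ 0 ∧ IsBDPLFunction ι' v κ γ f ΩK ((Ωp : unrIntegers p) : ℂ_[p]) L ∧
        ∀ (D : (W.baseChange K).LambdaAdicSelmerData κ γ) (F : HeegnerFamily N W K κ jbar)
          (X : (W.baseChange K).SelmerDualData κ γ) (j : ℤ_[p] →+* unrIntegers p),
          (∀ x : ℤ_[p], ((j x : unrIntegers p) : ℂ_[p]) = algebraMap ℚ_[p] ℂ_[p] (x : ℚ_[p])) →
          heegnerCharIdeal D F ^ 2 ≤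
              Module.charIdeal (IwasawaAlgebra p) (Submodule.torsion (IwasawaAlgebra p) X.X) →
            L ∈ (AcSelmer.XAc.charIdeal (W.baseChange K) p κ vbar ∅ γ).map (PowerSeries.map j))
    (h422 : BurungaleCastellaSkinner2025.prop422_exists_isBDPLFunction_mu_eq_zero)
    (h513 : thm513_exists_isBDPLFunction_valueAtOne_disc)
    (hC : ∀ (N : ℕ) [NeZero N], IsNewformOf.level_eq_conductorNorm (N := N)) :
    ∀ (W : WeierstrassCurve ℚ) [W.IsElliptic] [W.IsGloballyMinimal] (p : ℕ) [Fact p.Prime],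
      3 ≤ p → GoodOrd W p →
      ∀ (K : Type) [Field K] [NumberField K], IsImaginaryQuadratic K →
        SatisfiesHeegnerHypothesis (W.conductorNorm ℤ) K → SatisfiesHeegnerHypothesis p K →
        Odd (NumberField.discr K) → NumberField.discr K ≠ -3 →
        (W.baseChange K).HasIrreducibleModPGaloisRep p →
      ∀ (ι : K →+* ℚ_[p]) (v vbar : HeightOneSpectrum (𝓞 K)),
        (∀ x : 𝓞 K, x ∈ v.asIdeal ↔ ‖ι (x : K)‖ < 1) →
        ((p : ℕ) : 𝓞 K) ∈ vbar.asIdeal → vbar ≠ v →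
      ∀ (κ : ZpExtension K p), κ.IsAnticyclotomic →
      ∀ (γ : absoluteGaloisGroup K) [Fact (κ.IsTopGenerator γ)],
      ∀ (N : ℕ) [NeZero N] (Dt : ModularParametrizationData W N)
        (H : HeegnerDatum N (NumberField.discr K)) (ιC : K →+* ℂ) (P : (W.baseChange K).toAffine.Point),
        WeierstrassCurve.Affine.Point.map ιC.toRatAlgHom P = heegnerPointComplex Dt H →
        (∃ (jbar : AlgebraicClosure K →+* ℂ) (D : (W.baseChange K).LambdaAdicSelmerData κ γ)
            (F : HeegnerFamily N W K κ jbar) (X : (W.baseChange K).SelmerDualData κ γ),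
            heegnerCharIdeal D F ^ 2 ≤
              Module.charIdeal (IwasawaAlgebra p) (Submodule.torsion (IwasawaAlgebra p) X.X)) →
      ∀ (G : IwasawaAlgebra p),
        AcSelmer.XAc.charIdeal (W.baseChange K) p κ vbar ∅ γ = Ideal.span {G} →
        PowerSeries.constantCoeff G ≠ 0 →
        ∃ n : ℕ, AcSelmer.XAc.HasCharValuationAt (W.baseChange K) p κ vbar ∅ γ n ∧
          (n : ℤ) = 2 * ((padicValInt p (1 - W.frobeniusTrace p + p) : ℤ) - 1 +
            Literature.NumberTheory.EllipticCurves.padicLogOrd W p ι P) - 2 * (padicValInt p Dt.c : ℤ) := by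
  intro W _ _ p _ hp hord K _ _ hK hHN hHp hodd h3 hirrK ι v vbar hv hvbar hne κ hκ γ _ N _ Dt H ιC P hP
    hHow G hG hG0
  obtain ⟨htors, F, hF, u, hu⟩ := composite_of_printFacts_of_transfer h57 h59g h422 h513 hC W p hp hord K
    hK hHN hHp hodd h3 hirrK ι v vbar hv hvbar hne κ hκ γ N Dt H ιC P hP hHow
  -- `G = F · w` for a unit `w` of `Λ`; `w(0)` is a unit of `ℤ_p`
  obtain ⟨w, rfl⟩ := Ideal.span_singleton_eq_span_singleton.mp (hF.symm.trans hG)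
  have hw : IsUnit (PowerSeries.constantCoeff (w : IwasawaAlgebra p)) :=
    PowerSeries.isUnit_constantCoeff _ w.isUnit
  have hu' : ((PowerSeries.constantCoeff (F * (w : IwasawaAlgebra p)) : ℤ_[p]) : ℚ_[p]) =
      (((u * hw.unit : ℤ_[p]ˣ) : ℤ_[p]) : ℚ_[p]) * ((Dt.c : ℚ_[p])⁻¹) ^ 2 *
        (1 - (W.frobeniusTrace p : ℚ_[p]) * (p : ℚ_[p])⁻¹ + (p : ℚ_[p])⁻¹) ^ 2 *
        ((W.baseChange ℚ_[p]).padicLogPoint (formalIndex W p • padicPointOf W p ι P) /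
          (formalIndex W p : ℚ_[p])) ^ 2 := by
    rw [map_mul, PadicInt.coe_mul, hu, Units.val_mul, PadicInt.coe_mul, IsUnit.unit_spec]
    ring
  -- the left-hand side is non-zero, hence so is the right-hand side
  have hrhs : (((u * hw.unit : ℤ_[p]ˣ) : ℤ_[p]) : ℚ_[p]) * ((Dt.c : ℚ_[p])⁻¹) ^ 2 *
      (1 - (W.frobeniusTrace p : ℚ_[p]) * (p : ℚ_[p])⁻¹ + (p : ℚ_[p])⁻¹) ^ 2 *
      ((W.baseChange ℚ_[p]).padicLogPoint (formalIndex W p • padicPointOf W p ι P) /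
        (formalIndex W p : ℚ_[p])) ^ 2 ≠ 0 := by
    rw [← hu']
    exact PadicInt.coe_ne_zero.2 hG0
  have hval := congrArg Padic.valuation hu'
  rw [PadicInt.valuation_coe, valuation_unit_mul_bdpShape _ Dt.c (W.frobeniusTrace p) _ _ hrhs] at hval
  refine ⟨(PowerSeries.constantCoeff (F * (w : IwasawaAlgebra p))).valuation,
    AcSelmer.XAc.hasCharValuationAt_of_eq htors hG hG0 rfl, ?_⟩
  rw [hval, Literature.NumberTheory.EllipticCurves.padicLogOrd]

end ValuationCurrency

end Summit.BirchSwinnertonDyer.BirchSwinnertonDyer.Cruxes.TwoSidedLinkAnyClassNumberX10b.CompositeTransferX10b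

end
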